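import Summits.ResolutionOfSingularities.ResolutionOfSingularities.Theorems.HilbertSamuelEliminationSigmaMaxModificationsCorridor3WLadderIsoTransitionBirthDefs
import Summits.ResolutionOfSingularities.ResolutionOfSingularities.Theorems.HilbertSamuelEliminationSigmaMaxModificationsCorridor3WLadderMovingAltDefs
import HarnessLib

/-!
# [OURS · L1 W4.2] `Corridor3WLadderIsoTransitionBirth` — D17 (iii): the ALTERNATION ROW `WtopAltM p Q` from «no recurrent iso point births»
# and the iso → non-iso TRANSITION LAW (D17 (i), taken by name)

Crux chain w42 (`SigmaMaxModifications`, stmt-ResolutionOfSingularities-18506; conjunct stmt-ResolutionOfSingularities-19249). RULINGS v3.13-1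
(AJ) 09:02:58Z: «D17 … (ii)+(iii) TYPING `def NoRecurrentIsoPointBirth3 (p) (Q)` + `wtopAltM_of_noRecurrentIsoPointBirth3` (logic over 012's
`WtopAltM`) → res-type-067; (i) the TRANSITION LEMMA … → res-type-053 successor». Part (ii) is p517090 (`IsIsoPointBirthAt`,
`NoRecurrentIsoPointBirth3`, event re-keyed per res-L1-type-o1's vacuity note); res-type-012's D16 Defs p517919 give `WtopAltM`. THIS FILE:
* `IsoTransitionLaw3 p Q` — D17 (i) as a CHAIN-LEVEL LAW, the hypothesis the composition consumes BY NAME: along every chain of canonical near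
  steps with `3 ≤ ē` from a `Q`-maximal origin (functional admissible oracle), an iso → non-iso transition at consecutive stages is a blown-down
  step carrying an ISO POINT BIRTH through the chain point (`∃ f, StepProjection … ∧ ∃ Z', IsIsoPointBirthAt 3 ν (c n) (c (n+1)) f Z'`). Content
  for its prover (res-type-053-successor): waiting steps preserve isolation (`CanonicalNearStep.stratumIsolated_of_not_isBlownUp`, UnitStart), so a
  transition step is blown up with centre `{x_n}` (isolated point), every component of `X_{n+1}(ν)` through `x_{n+1}` lies in the fibre
  (`BlowupOffCentre`), and non-isolation of `x_{n+1}` gives one such component `≠ {x_{n+1}}`. OURS CLAIM until discharged; NOT a statement of any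
  manuscript.
* `wtopAltM_of_noRecurrentIsoPointBirth3 : IsoTransitionLaw3 p Q → NoRecurrentIsoPointBirth3 p Q → WtopAltM p Q` — PROVED (pure logic: an
  alternating chain has iso → non-iso transitions beyond every stage — take the first non-isolated stage after a late isolated one —, each is an
  iso point birth by the law, contradicting eventual absence).
Typer res-type-067 (gen 11). OURS; AI-typed, weaker than expert review. Helper file `--supports stmt-ResolutionOfSingularities-19249 --as helper`
(counted 0).
-/

noncomputable section

set_option linter.dupNamespace false

open CategoryTheory AlgebraicGeometry TopologicalSpace Topology
open Summit.ResolutionOfSingularities.ResolutionOfSingularities.Theorems.CampaignW42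
open Literature.AlgebraicGeometry.Resolution Literature.RingTheory.HilbertSamuel
open Summit.ResolutionOfSingularities.ResolutionOfSingularities.Theorems.SigmaMaxModificationsCorridor3
open Summit.ResolutionOfSingularities.ResolutionOfSingularities.Cruxes.SigmaMaxModifications.IdeasL1Idea2R4
  (WtopAltM MaxOriginNoMovingAlternatingNearChainAtQ NoMovingAlternatingNearChainFrom)

namespace Summit.ResolutionOfSingularities.ResolutionOfSingularities.Theorems.SigmaMaxModificationsCorridor3.Moving

universe u

/-- [OURS · L1 W4.2] **THE ISO → NON-ISO TRANSITION LAW** (D17 (i) at chain level; OURS CLAIM until res-type-053-successor's transition lemma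
discharges it): along every chain of canonical near steps with `3 ≤ ē` from a `Q`-maximal origin of characteristic `p` at level `3` (functional
admissible oracle), if `x_n` is isolated in the HS-max locus and `x_{n+1}` is not, then the blow-down of the step carries an iso point birth
through `x_{n+1}` (`IsIsoPointBirthAt`, p517090). NOT a statement of any manuscript. -/
def IsoTransitionLaw3 (p : ℕ) (Q : ℕ → (ℕ → ℕ) → ∀ X : Scheme.{u}, X → Prop) : Prop :=
  ∀ (R : ∀ S : Scheme.{u}, CentreSeq S → Prop), OracleFunctional R → OracleAdmissible R →
  ∀ (ν : ℕ → ℕ) (X : Scheme.{u}) [IsLocallyNoetherian X] (x : X), IsMaximalOrigin p 3 ν X x → Q 3 ν X x →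
  ∀ c : ℕ → MarkedStage.{u}, Reaches R 3 ν (MarkedStage.init X x) (c 0) →
    (∀ n, CanonicalNearStep R 3 ν (c n) (c (n + 1))) → (∀ n, 3 ≤ (c n).geomDirDim) →
    ∀ n, Iso 3 (c n) → ¬ Iso 3 (c (n + 1)) →
      ∃ f : (c (n + 1)).W ⟶ (c n).W, StepProjection R 3 ν (c n) (c (n + 1)) f ∧ ∃ Z', IsIsoPointBirthAt 3 ν (c n) (c (n + 1)) f Z'

/-- **D17 (iii) — `WtopAltM p Q` FROM «NO RECURRENT ISO POINT BIRTHS» (proved logic).** An alternating moving chain (isolated infinitely often AND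
non-isolated infinitely often) has an iso → non-iso transition at consecutive stages beyond every bound: after a late isolated stage `m` take the
FIRST later non-isolated stage `j₀`; then `x_{j₀−1}` is isolated and `x_{j₀}` is not. By the transition law that step carries an iso point birth,
which `NoRecurrentIsoPointBirth3` forbids from some stage on. [folklore] -/
theorem wtopAltM_of_noRecurrentIsoPointBirth3 {p : ℕ} {Q : ℕ → (ℕ → ℕ) → ∀ X : Scheme.{u}, X → Prop}
    (hT : IsoTransitionLaw3 p Q) (hrec : NoRecurrentIsoPointBirth3 p Q) : WtopAltM.{u} p Q := by
  classical
  intro R hRf hRa ν X _ x hX hQ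
  rintro ⟨c, h0, hstep, hG, hmov, hio, hnio⟩
  obtain ⟨n₁, hn₁⟩ := hrec R hRf hRa ν X x hX hQ c h0 hstep hG hmov
  obtain ⟨m, hm, hmI⟩ := hio n₁
  obtain ⟨m', hm', hm'N⟩ := hnio m
  have hex : ∃ j, m < j ∧ ¬ Iso 3 (c j) := by
    refine ⟨m', lt_of_le_of_ne hm' ?_, hm'N⟩
    rintro rfl
    exact hm'N hmI
  obtain ⟨hj₀m, hj₀N⟩ := Nat.find_spec hex
  have hmin : ∀ j, j < Nat.find hex → ¬ (m < j ∧ ¬ Iso 3 (c j)) := fun j hj => Nat.find_min hex hj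
  obtain ⟨k, hk⟩ : ∃ k, Nat.find hex = k + 1 := Nat.exists_eq_succ_of_ne_zero (by omega)
  have hkI : Iso 3 (c k) := by
    by_cases hkm : k = m
    · rw [hkm]; exact hmI
    · by_contra hnot
      exact hmin k (by omega) ⟨by omega, hnot⟩
  have hk1 : ¬ Iso 3 (c (k + 1)) := by
    rw [← hk]; exact hj₀N
  obtain ⟨f, hf, Z', hZ'⟩ := hT R hRf hRa ν X x hX hQ c h0 hstep hG k hkI hk1
  exact hn₁ k (by omega) f hf Z' hZ'

end Summit.ResolutionOfSingularities.ResolutionOfSingularities.Theorems.SigmaMaxModificationsCorridor3.Moving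

end
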